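import Literature.NumberTheory.DiophantineGeometry.AbcValuationProduct
import HarnessLib

/-!
# A linear-forms-in-logarithms bound for the number of divisors of an abc triple
# (Pasten, *Shimura curves and the abc conjecture*, Proposition 15.1)

Topic `NumberTheory/DiophantineGeometry`; vocabulary of `AbcWave0` / `AbcValuationProduct`
(`IsABCTriple`, `rad`, `Nat.divisors`, `Nat.primeFactors`).

H. Pasten, *Shimura curves and the abc conjecture*, J. Number Theory 254 (2024) 214–335
(= arXiv:1705.09251; held and read: arXiv v4, §15.1 "An application of linear forms in
logarithms", label `PropLFL`), **Proposition 15.1** (arXiv v4 numbering, as for the other results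
of this paper vendored in `AbcValuationProduct` / `PastenValuationProducts`):

> **Proposition 15.1.** Let `ε > 0`. There is a constant `C_ε > 1` such that for all triples
> `a, b, c` of coprime positive integers with `a + b = c`, we have
> `d(abc) / (log d(abc))^ν < C_ε^ν · ν^{2ν²} · rad(abc)^{1 + εν}`
> where `ν = ω(abc)` is the number of distinct prime divisors of `abc`. In particular, if we
> consider `ν` as fixed, then for those triples `a, b, c` we have
> `d(abc) ≪_{ε,ν} rad(abc)^{1+ε}`.

Here `d(n)` is the number of divisors and `log` the natural logarithm; for an abc triple
`abc ≥ 2`, so `ν ≥ 1`, `d(abc) ≥ 2` and `log d(abc) > 0`.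

Printed proof (loc. cit.): for `p ∣ a`, `v_p(abc) = v_p(a) = v_p(b/c − 1)`, and the Corollary on
p. 245 of K. Yu, *Linear forms in `p`-adic logarithms III*, Compositio Math. 91 (1994)
[Yu1994] gives `v_p(abc) ≪ (ν_b + ν_c)^{3(ν_b + ν_c)} · p · L_b L_c log(L_b L_c) log d(bc)` with
`L_x = ∏_{q ∣ x} (1 + log q)`; multiplying over `p ∣ abc` and using
`∏_{p ∣ m} (1 + log p) ≪_ε rad(m)^ε` (raised to the `ν`-th power, whence `C_ε^ν`) gives the
claim. Yu's 1994 theorem is not in the tree — the tree's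
`Literature.Barriers.ABC.yu2007_padicLogForm_rat` is the 2007 version over `ℚ`, whose constant
`(16e)^{2(n+1)} n^{3/2} log(2n) log 2` would replace the factor `ν^{2ν²}` by `exp(O(ν²))`, cf.
§15.2 of the paper — so the proposition is vendored as the NAMED FACT
`pastenShimura2024_prop_15_1` (CONVENTIONS §4), stated exactly as the printed display.

Proved here:
* `pastenShimura2024_prop_15_1.card_divisors_lt` / `pastenShimura2024_prop_15_1_iff_card_divisors_lt`:
  the multiplied-out form `d(abc) < C_ε^ν ν^{2ν²} rad(abc)^{1+εν} (log d(abc))^ν` and its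
  equivalence with the printed display (`log d(abc) > 0`);
* `pastenShimura2024_prop_15_1.card_divisors_le_of_card_primeFactors_eq`: the "in particular"
  clause — for fixed `ν` and `ε > 0`, `d(abc) ≤ K_{ε,ν} · rad(abc)^{1+ε}` for the abc triples with
  `ω(abc) = ν` (from the display with `ε/(2(ν+1))` and `(log d)^ν ≤ ((ν+1)/η)^ν d^η`,
  `η = ε/(2(1+ε))`).

Role in the tree: a calibration rung (exponent `1 + εν`, i.e. `1 + o(1)` for bounded or slowly
growing `ω(abc)`) below Pasten's Theorem 16.8 (`pasten2024_thm_2_5`, exponent `8/3 + ε` uniformly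
in `ν`), wanted by the crux `Summit.ABC.ABC.Theses.RibetTakahashiSplit.ManyPrimeValuationProductFrey`.

What is NOT here: Lemma 15.2 of the paper (`v_2(abc) < C'_ε rad(abc)^ε`, via Stewart–Yu), Yu's
1994 corollary itself, and the `exp(O(ν²))` variant of §15.2 (a heuristic in print, not a stated
result).

## References

* [PastenShimura2024] H. Pasten, *Shimura curves and the abc conjecture*, J. Number Theory 254
  (2024) 214–335, doi:10.1016/j.jnt.2023.07.002, arXiv:1705.09251v4 — §15.1, Proposition 15.1.
* [Yu1994] K. Yu, *Linear forms in `p`-adic logarithms III*, Compositio Math. 91 (1994),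
  241–276 — Corollary to Theorem 1, p. 245 (the input of the printed proof; not vendored).
-/

noncomputable section

namespace Literature.NumberTheory.DiophantineGeometry

/-! ### Elementary facts: `abc ≥ 2`, `d(abc) ≥ 2`, `log d(abc) > 0` -/

/-- For an abc triple, `abc ≥ 2` (`a, b ≥ 1` and `c = a + b ≥ 2`). [folklore] -/
theorem IsABCTriple.two_le_mul {a b c : ℕ} (h : IsABCTriple a b c) : 2 ≤ a * b * c := by
  obtain ⟨ha, hb, habc, -⟩ := h
  have hc : 2 ≤ c := by omega
  calc 2 = 1 * 1 * 2 := by norm_num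
    _ ≤ a * b * c := Nat.mul_le_mul (Nat.mul_le_mul ha hb) hc

/-- `d(n) ≥ 2` for `n ≥ 2` (the divisors `1` and `n` are distinct). [folklore] -/
theorem two_le_card_divisors {n : ℕ} (hn : 2 ≤ n) : 2 ≤ n.divisors.card := by
  rw [Nat.succ_le_iff, Finset.one_lt_card]
  exact ⟨1, Nat.one_mem_divisors.2 (by omega), n, Nat.mem_divisors_self n (by omega), by omega⟩

/-- For an abc triple, `log d(abc) > 0`. [folklore] -/
theorem IsABCTriple.log_card_divisors_pos {a b c : ℕ} (h : IsABCTriple a b c) :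
    0 < Real.log ((a * b * c).divisors.card : ℝ) := by
  apply Real.log_pos
  have h2 : 2 ≤ (a * b * c).divisors.card := two_le_card_divisors h.two_le_mul
  exact_mod_cast h2

/-! ### The named fact -/

/-- NAMED FACT — **Pasten, J. Number Theory 254 (2024), Proposition 15.1** (arXiv:1705.09251v4
numbering, label `PropLFL`; "a simple consequence of the theory of linear forms in `p`-adic
logarithms", PROVED in print from the Corollary on p. 245 of Yu 1994 — a theorem, vendored as a
named fact only because Yu's 1994 bound is not in the tree). Printed statement: "Let
`ε > 0`. There is a constant `C_ε > 1` such that for all triples `a, b, c` of coprime positive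
integers with `a + b = c`, we have `d(abc) / (log d(abc))^ν < C_ε^ν ν^{2ν²} rad(abc)^{1+εν}` where
`ν = ω(abc)` is the number of distinct prime divisors of `abc`." Rendering: `d(abc) =
(a*b*c).divisors.card`, `ν = (a*b*c).primeFactors.card`, `rad(abc) = rad a b c` (the radical in
`ℕ`), natural logarithm, `rad(abc)^{1+εν}` a real power (`Real.rpow`), `C_ε^ν` and `ν^{2ν²}`
monoid powers; for an abc triple `log d(abc) > 0` (`IsABCTriple.log_card_divisors_pos`), so the
quotient is a genuine quotient. Users take `(h : pastenShimura2024_prop_15_1)`.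
[cite: PastenShimura2024, Proposition 15.1 (§15.1; arXiv:1705.09251v4 numbering)] -/
def pastenShimura2024_prop_15_1 : Prop :=
  ∀ ε : ℝ, 0 < ε → ∃ C : ℝ, 1 < C ∧ ∀ a b c : ℕ, IsABCTriple a b c →
    ((a * b * c).divisors.card : ℝ) /
        Real.log ((a * b * c).divisors.card : ℝ) ^ (a * b * c).primeFactors.card <
      C ^ (a * b * c).primeFactors.card *
        ((a * b * c).primeFactors.card : ℝ) ^ (2 * (a * b * c).primeFactors.card ^ 2) *
        (rad a b c : ℝ) ^ ((1 : ℝ) + ε * (a * b * c).primeFactors.card)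

/-! ### The multiplied-out form -/

/-- **Proposition 15.1, multiplied out:** `d(abc) < C_ε^ν · ν^{2ν²} · rad(abc)^{1+εν} ·
(log d(abc))^ν` for every abc triple, `ν = ω(abc)` (from the named fact, since
`(log d(abc))^ν > 0`). [cite: PastenShimura2024, Proposition 15.1 (§15.1; arXiv:1705.09251v4 numbering)] -/
theorem pastenShimura2024_prop_15_1.card_divisors_lt (h : pastenShimura2024_prop_15_1) :
    ∀ ε : ℝ, 0 < ε → ∃ C : ℝ, 1 < C ∧ ∀ a b c : ℕ, IsABCTriple a b c →
      ((a * b * c).divisors.card : ℝ) <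
        C ^ (a * b * c).primeFactors.card *
          ((a * b * c).primeFactors.card : ℝ) ^ (2 * (a * b * c).primeFactors.card ^ 2) *
          (rad a b c : ℝ) ^ ((1 : ℝ) + ε * (a * b * c).primeFactors.card) *
          Real.log ((a * b * c).divisors.card : ℝ) ^ (a * b * c).primeFactors.card := by
  intro ε hε
  obtain ⟨C, hC, hb⟩ := h ε hε
  refine ⟨C, hC, fun a b c habc => ?_⟩
  have hlog := pow_pos habc.log_card_divisors_pos (a * b * c).primeFactors.card
  exact (div_lt_iff₀ hlog).1 (hb a b c habc)

/-- Converse direction: the multiplied-out form gives back the printed display.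
[cite: PastenShimura2024, Proposition 15.1 (§15.1; arXiv:1705.09251v4 numbering)] -/
theorem pastenShimura2024_prop_15_1_of_card_divisors_lt
    (h : ∀ ε : ℝ, 0 < ε → ∃ C : ℝ, 1 < C ∧ ∀ a b c : ℕ, IsABCTriple a b c →
      ((a * b * c).divisors.card : ℝ) <
        C ^ (a * b * c).primeFactors.card *
          ((a * b * c).primeFactors.card : ℝ) ^ (2 * (a * b * c).primeFactors.card ^ 2) *
          (rad a b c : ℝ) ^ ((1 : ℝ) + ε * (a * b * c).primeFactors.card) *
          Real.log ((a * b * c).divisors.card : ℝ) ^ (a * b * c).primeFactors.card) :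
    pastenShimura2024_prop_15_1 := by
  intro ε hε
  obtain ⟨C, hC, hb⟩ := h ε hε
  refine ⟨C, hC, fun a b c habc => ?_⟩
  have hlog := pow_pos habc.log_card_divisors_pos (a * b * c).primeFactors.card
  exact (div_lt_iff₀ hlog).2 (hb a b c habc)

/-- The printed display of Proposition 15.1 and its multiplied-out form are equivalent.
[cite: PastenShimura2024, Proposition 15.1 (§15.1; arXiv:1705.09251v4 numbering)] -/
theorem pastenShimura2024_prop_15_1_iff_card_divisors_lt :
    pastenShimura2024_prop_15_1 ↔
      ∀ ε : ℝ, 0 < ε → ∃ C : ℝ, 1 < C ∧ ∀ a b c : ℕ, IsABCTriple a b c →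
        ((a * b * c).divisors.card : ℝ) <
          C ^ (a * b * c).primeFactors.card *
            ((a * b * c).primeFactors.card : ℝ) ^ (2 * (a * b * c).primeFactors.card ^ 2) *
            (rad a b c : ℝ) ^ ((1 : ℝ) + ε * (a * b * c).primeFactors.card) *
            Real.log ((a * b * c).divisors.card : ℝ) ^ (a * b * c).primeFactors.card :=
  ⟨pastenShimura2024_prop_15_1.card_divisors_lt, pastenShimura2024_prop_15_1_of_card_divisors_lt⟩

/-! ### The "in particular" clause: fixed `ν` -/

/-- `(log x)^ν ≤ ((ν + 1)/η)^ν · x^η` for `x ≥ 1`, `η > 0` (from `log x ≤ x^{η/(ν+1)} (ν+1)/η`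
and `x^{ην/(ν+1)} ≤ x^η`). [folklore] -/
theorem log_pow_le_mul_rpow {x η : ℝ} (hx : 1 ≤ x) (hη : 0 < η) (ν : ℕ) :
    Real.log x ^ ν ≤ (((ν : ℝ) + 1) / η) ^ ν * x ^ η := by
  have hx0 : 0 ≤ x := zero_le_one.trans hx
  have hlog0 : 0 ≤ Real.log x := Real.log_nonneg hx
  have hν1 : (0 : ℝ) < (ν : ℝ) + 1 := by positivity
  have hη' : 0 < η / ((ν : ℝ) + 1) := by positivity
  have h1 : Real.log x ≤ x ^ (η / ((ν : ℝ) + 1)) / (η / ((ν : ℝ) + 1)) :=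
    Real.log_le_rpow_div hx0 hη'
  have h2 : Real.log x ^ ν ≤ (x ^ (η / ((ν : ℝ) + 1)) / (η / ((ν : ℝ) + 1))) ^ ν :=
    pow_le_pow_left₀ hlog0 h1 ν
  have h3 : (x ^ (η / ((ν : ℝ) + 1))) ^ ν ≤ x ^ η := by
    rw [← Real.rpow_natCast, ← Real.rpow_mul hx0]
    refine Real.rpow_le_rpow_of_exponent_le hx ?_
    rw [div_mul_eq_mul_div, div_le_iff₀ hν1]
    nlinarith [hη.le, (Nat.cast_nonneg ν : (0 : ℝ) ≤ ν)]
  calc Real.log x ^ ν ≤ (x ^ (η / ((ν : ℝ) + 1)) / (η / ((ν : ℝ) + 1))) ^ ν := h2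
    _ = (((ν : ℝ) + 1) / η) ^ ν * (x ^ (η / ((ν : ℝ) + 1))) ^ ν := by
        rw [div_pow, div_eq_mul_inv, ← inv_pow, inv_div, mul_comm]
    _ ≤ (((ν : ℝ) + 1) / η) ^ ν * x ^ η := mul_le_mul_of_nonneg_left h3 (by positivity)

/-- **Proposition 15.1, "in particular" clause:** for fixed `ν` and `ε > 0` there is
`K = K_{ε,ν} > 0` with `d(abc) ≤ K · rad(abc)^{1+ε}` for every abc triple with `ω(abc) = ν`
("if we consider `ν` as fixed, then for those triples `a, b, c` we have
`d(abc) ≪_{ε,ν} rad(abc)^{1+ε}`"). Derived from the named fact applied with `ε/(2(ν+1))`,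
the bound `(log d)^ν ≤ ((ν+1)/η)^ν d^η` with `η = ε/(2(1+ε))`, and `(1 + ε/2)/(1 − η) = 1 + ε`.
[cite: PastenShimura2024, Proposition 15.1 (§15.1; arXiv:1705.09251v4 numbering)] -/
theorem pastenShimura2024_prop_15_1.card_divisors_le_of_card_primeFactors_eq
    (h : pastenShimura2024_prop_15_1) (ε : ℝ) (hε : 0 < ε) (ν : ℕ) :
    ∃ K : ℝ, 0 < K ∧ ∀ a b c : ℕ, IsABCTriple a b c → (a * b * c).primeFactors.card = ν →
      ((a * b * c).divisors.card : ℝ) ≤ K * (rad a b c : ℝ) ^ (1 + ε) := by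
  -- the auxiliary exponent `η = ε / (2(1+ε)) ∈ (0,1)` with `(1 + ε/2) / (1 - η) = 1 + ε`
  set η : ℝ := ε / (2 * (1 + ε)) with hη_def
  have hη : 0 < η := by positivity
  have h1ε : (1 + ε) ≠ 0 := by positivity
  have hη1 : η < 1 := by
    rw [hη_def, div_lt_one (by positivity)]
    linarith
  have h1η : 0 < 1 - η := by linarith
  have hkey : (1 + ε / 2) * (1 / (1 - η)) = 1 + ε := by
    rw [mul_one_div, div_eq_iff h1η.ne', hη_def]
    field_simp
    ring
  obtain ⟨C, hC, hb⟩ := h.card_divisors_lt (ε / (2 * (ν + 1))) (by positivity)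
  have hC0 : 0 ≤ C := by linarith
  set M : ℝ := C ^ ν * (ν : ℝ) ^ (2 * ν ^ 2) * (((ν : ℝ) + 1) / η) ^ ν with hM_def
  have hM : 0 ≤ M := by positivity
  refine ⟨M ^ (1 / (1 - η)) + 1, by positivity, fun a b c habc hν => ?_⟩
  have hb' := hb a b c habc
  rw [hν] at hb'
  have hd2 : (2 : ℝ) ≤ ((a * b * c).divisors.card : ℝ) := by
    exact_mod_cast two_le_card_divisors habc.two_le_mul
  set d : ℝ := ((a * b * c).divisors.card : ℝ) with hd_def
  set R : ℝ := (rad a b c : ℝ) with hR_def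
  set s : ℝ := (1 : ℝ) + ε / (2 * ((ν : ℝ) + 1)) * (ν : ℝ) with hs_def
  have hd0 : 0 < d := by linarith
  have hd1 : 1 ≤ d := by linarith
  have hR1 : 1 ≤ R := by
    -- `rad(abc) ≥ 1` (the radical in `ℕ` is positive); cf. `Barriers.ABC.one_le_rad_real`
    have h0 : 0 < rad a b c := by
      rw [rad_def]
      exact Nat.radical_pos _
    rw [hR_def]
    exact_mod_cast h0
  have hR0 : 0 < R := by linarith
  -- Step 1: `(log d)^ν ≤ ((ν+1)/η)^ν d^η`, hence `d < M R^s d^η`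
  have h2 : Real.log d ^ ν ≤ (((ν : ℝ) + 1) / η) ^ ν * d ^ η := log_pow_le_mul_rpow hd1 hη ν
  have hA : 0 ≤ C ^ ν * (ν : ℝ) ^ (2 * ν ^ 2) * R ^ s := by positivity
  have h3 : d < M * R ^ s * d ^ η :=
    calc d < C ^ ν * (ν : ℝ) ^ (2 * ν ^ 2) * R ^ s * Real.log d ^ ν := hb'
      _ ≤ C ^ ν * (ν : ℝ) ^ (2 * ν ^ 2) * R ^ s * ((((ν : ℝ) + 1) / η) ^ ν * d ^ η) :=
          mul_le_mul_of_nonneg_left h2 hA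
      _ = M * R ^ s * d ^ η := by rw [hM_def]; ring
  -- Step 2: `d^{1-η} < M R^s`, so `d < (M R^s)^{1/(1-η)} = M^{1/(1-η)} R^{s/(1-η)}`
  have h4 : d ^ (1 - η) < M * R ^ s := by
    rw [Real.rpow_sub hd0, Real.rpow_one, div_lt_iff₀ (Real.rpow_pos_of_pos hd0 η)]
    exact h3
  have h5 : d < (M * R ^ s) ^ (1 / (1 - η)) :=
    calc d = (d ^ (1 - η)) ^ (1 / (1 - η)) := by
          rw [← Real.rpow_mul hd0.le, mul_one_div_cancel h1η.ne', Real.rpow_one]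
      _ < (M * R ^ s) ^ (1 / (1 - η)) :=
          Real.rpow_lt_rpow (Real.rpow_nonneg hd0.le _) h4 (by positivity)
  -- Step 3: `s/(1-η) ≤ (1 + ε/2)/(1-η) = 1 + ε` and `R ≥ 1`
  have hs : s ≤ 1 + ε / 2 := by
    have : ε / (2 * ((ν : ℝ) + 1)) * (ν : ℝ) ≤ ε / 2 := by
      rw [div_mul_eq_mul_div, div_le_div_iff₀ (by positivity) (by positivity)]
      nlinarith [hε.le, (Nat.cast_nonneg ν : (0 : ℝ) ≤ ν)]
    rw [hs_def]
    linarith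
  have h6 : (M * R ^ s) ^ (1 / (1 - η)) ≤ M ^ (1 / (1 - η)) * R ^ (1 + ε) := by
    rw [Real.mul_rpow hM (Real.rpow_nonneg hR0.le _), ← Real.rpow_mul hR0.le]
    refine mul_le_mul_of_nonneg_left (Real.rpow_le_rpow_of_exponent_le hR1 ?_)
      (Real.rpow_nonneg hM _)
    calc s * (1 / (1 - η)) ≤ (1 + ε / 2) * (1 / (1 - η)) :=
          mul_le_mul_of_nonneg_right hs (by positivity)
      _ = 1 + ε := hkey
  have hRpos : 0 ≤ R ^ (1 + ε) := Real.rpow_nonneg hR0.le _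
  calc d ≤ M ^ (1 / (1 - η)) * R ^ (1 + ε) := (h5.trans_le h6).le
    _ ≤ (M ^ (1 / (1 - η)) + 1) * R ^ (1 + ε) := by nlinarith

end Literature.NumberTheory.DiophantineGeometry

end
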